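import Summits.ABC.IUTFork.Cor312SlotHull
import Summits.ABC.IUTFork.Conditional.AbcOfSOrNumK
import Summits.ABC.IUTFork.LDHGenuinePerImageSufficiencyNum
import Summits.ABC.ABC.Theorems.IUTThetaPilotABCOfCor312
import HarnessLib

/-!
# Branch C, K line, READING (P) — the γ certificate: `ABC` ⟸ [per admissible SZPIRO-BAD datum: WHEREVER the SLOT licence (the (xi-f)
# inclusion into the (Ind1)-FREE hull) FAILS, the PER-IMAGE number-level Corollary] + the per-image Θ-side READ; NO CONE BINDER AT ALL
# (C-lead rulings C-R28 (3)(γ) / C-R35 (3)(γ) / C-R38; typing gap closed by `Cor312SlotHull.lean`)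

C scoreboard (abc-iut-C-cert-2 gen 3, ODD-revision writer + HYPS.tsv keeper). PROOF-ONLY (no `def`, no new `Prop`, no instance, no notation;
nothing re-typed — the reading-(P) vocabulary `thetaSlotHull` / `SlotLicence` / `negLogThetaSlot` / `SlotStatement` lives in
`Summits/ABC/IUTFork/Cor312SlotHull.lean`, shape named by abc-iut-c312-1 2026-08-26T16:47:09Z).

WHY READING (P). On the (U) line ([IUTchIII] Cor. 3.12 as stated: hull of the union of ALL possible images, (Ind1) capsule permutations
included) the cone carries the hull-regime estimate with print's `B_III`, KERNEL-FALSE as typed at mixed data (`Conditional.not_hreg_v4`,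
p453135) — VERDICT RISK ¶7 realised: the (Ind1) slot permutations inflate OUR typed hull at a mixed prime. In reading (P) (Dupuy–Hilado §4.11–4.12:
the hull of the (Ind2)-SLOT images only) the per-image `B_III` estimate is abc-iut-S3's PINNED theorem at EVERY datum
(`PointDict.gap_le_BIII_of_cor312PerImageAtDatum`, abc-iut-c312-d1 p448494), so NO cone binder is needed anywhere; the price is that the S-side
clause is the STRONGER per-slot-hull reading of Step (xi-f) (`Cor312.Setting.SlotLicence ⟹ Thm311ToCor312.Licence`, `licence_of_slotLicence`).

* `GenuineKSlot.cor312PerImageOf_of_slotStatement` — per genuine datum `T` at the sharp K-setting of the CHOSEN realising ideles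
  (`settingPrVolSharp (pilotDataOfK T.D T.K) …`): `SlotStatement` + the READ-P bound `negLogThetaSlot ≤ ↑T.negLogThetaPerImage` ⟹
  `T.Cor312PerImageOf` (q-side READ by abc-iut-c312-7 `negLogQ_settingPrVolSharp` + abc-iut-C-cert-3 `absLogq_eq_ndeg_qPilot_pilotDataOfK` +
  abc-iut-c312-8 `negAbsLogQ_eq_neg_absLogq_of_isVolumeInputOf`);
* `GenuineKSlot.cor312PerImageOf_of_slotLicence` — the same from `SlotLicence` (monotone log-volume = abc-iut-c312-7's
  `bridgeHyps_settingPrVolSharp_of_ideles …|>.mono`, a THEOREM; finiteness of `−|log(Θ)|_(P)` follows from the READ-P bound itself);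
* **`abc_of_slotLicence_orNumP_K_szpiroBad`** — DATA = the K-line certificates' VERBATIM; HYPOTHESES: [NUM-P-OFF, Szpiro-bad] `hNumPOffBad` «at
  every admissible SZPIRO-BAD `(P, l)` and genuine `T` at which the SLOT licence FAILS, `T.Cor312PerImageOf`» · [READ-P] `hReadP` «at every
  genuine `T`, `negLogThetaSlot (sharp K-setting, chosen ideles) ≤ ↑T.negLogThetaPerImage`» (the (Ind2)-slot-hull twin of abc-iut-s2-p7's
  (U)-READ p453133; abc-iut-s2-p7 «HΘP-K» in flight — on landing this binder is discharged and the count drops to 1). Tail: abc-iut-c312-d1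
  `Cor22.forall_cor312PerImageOf_of_szpiroBad` (Szpiro-good case = `cor312PerImageAtDatum_of_szpiro`, nothing assumed) + abc-iut-S2
  `ABC_of_cor312PerImage`. Explicit 2 = NUM-P-OFF 1 · READ-P 1; **CONE 0** · PIN 0 · SIDE 0.

HONEST STRENGTH / COST: `hNumPOffBad` is an assumption label for the PER-IMAGE number-level Corollary (Dupuy–Hilado's (1.1) shape at the datum —
STRONGER than the (U) number `T.Cor312Of`) exactly at would-be-Szpiro-violating admissible data where our SLOT licence fails; `SlotLicence` is a
STRONGER-THAN-PRINT reading of Step (xi-f) (print: hull of the union of all possible images, p. 184 l. 26–29); where the slot licence HOLDS nothing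
number-level is assumed (the per-image Corollary is then a theorem modulo READ-P). Nothing here asserts that abc is proved or refuted, or that
[IUTchIII] Cor. 3.12 / Thm. 3.11 or [IUTchIV] Thm. 1.10 holds or fails at any datum, or takes a side on any author (Mochizuki / Scholze–Stix /
Joshi / Dupuy–Hilado) or on the reading (U)/(P); typed ≠ proved; instantiated ≠ endorsed; refuted-as-typed ≠ refuted-in-print.
[claim: Mochizuki2012, status: disputed] [cite: Mochizuki2012, IUTchIII Cor. 3.12 p. 173–174, Step (x) p. 181, Step (xi-f) p. 184; IUTchIV Thm. 1.10
p. 22–31, Cor. 2.2 (ii)–(iii) p. 43–47] [cite: DupuyHilado2025, §1 (1.1), §3.3–3.4, §4.11–4.12]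
-/

noncomputable section

namespace Summit.ABC.IUTFork.Conditional

open Set Function NumberField IsDedekindDomain
open Thm311 Thm311.Real Cor312 Cor312Vol Cor312Prov Literature.IUT.LogThetaLattice Literature.IUT.LogVolume
  Literature.IUT.HodgeTheaters Literature.IUT.LogVolume.ThetaData
open Literature.NumberTheory.DiophantineGeometry.GenEll Summit.ABC.ABC.Theorems

section Family

/-! ## §0. DATA — the K-line certificates' context binders VERBATIM (p451044 / p452637 / p457468), as section variables -/

variable
    (M : ∀ (P : NFPoint) (l : ℕ) (T : Cor22.ThetaVolumeDatumAt P l), Type) [∀ P l T, Field (M P l T)] [∀ P l T, NumberField (M P l T)]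
    (archPk : ∀ (P : NFPoint) (l : ℕ) (T : Cor22.ThetaVolumeDatumAt P l), letI := T.instFieldF; letI := T.instNumberFieldF; letI := T.instAlgebraF; letI := T.instFieldK;
        letI := T.instNumberFieldK; letI := T.instAlgebraK; letI := T.instFieldFbar; letI := T.instAlgebraFbar;
        letI := T.instAlgebraKFbar; letI := T.instIsElliptic;
      ∀ (j : (thetaIndex (pilotDataOfK T.D T.K)).Label) (vQ : (thetaIndex (pilotDataOfK T.D T.K)).VQ), Set ((logShellsDH (pilotDataOfK T.D T.K) (analyticLogv T.K)).Packet j vQ))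
    (archSub : ∀ (P : NFPoint) (l : ℕ) (T : Cor22.ThetaVolumeDatumAt P l), letI := T.instFieldF; letI := T.instNumberFieldF; letI := T.instAlgebraF; letI := T.instFieldK;
        letI := T.instNumberFieldK; letI := T.instAlgebraK; letI := T.instFieldFbar; letI := T.instAlgebraFbar;
        letI := T.instAlgebraKFbar; letI := T.instIsElliptic;
      ∀ (j : (thetaIndex (pilotDataOfK T.D T.K)).Label) (v : (thetaIndex (pilotDataOfK T.D T.K)).V), Set ((logShellsDH (pilotDataOfK T.D T.K) (analyticLogv T.K)).Packet j ((thetaIndex (pilotDataOfK T.D T.K)).over v)))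
    (Ψ : ∀ (P : NFPoint) (l : ℕ) (T : Cor22.ThetaVolumeDatumAt P l), letI := T.instFieldF; letI := T.instNumberFieldF; letI := T.instAlgebraF; letI := T.instFieldK;
        letI := T.instNumberFieldK; letI := T.instAlgebraK; letI := T.instFieldFbar; letI := T.instAlgebraFbar;
        letI := T.instAlgebraKFbar; letI := T.instIsElliptic;
      ℤ → ∀ v : (thetaIndex (pilotDataOfK T.D T.K)).V, v ∈ (thetaIndex (pilotDataOfK T.D T.K)).Vbad → Set ((logShellsDH (pilotDataOfK T.D T.K) (analyticLogv T.K)).StarPacket v))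
    (act : ∀ (P : NFPoint) (l : ℕ) (T : Cor22.ThetaVolumeDatumAt P l), letI := T.instFieldF; letI := T.instNumberFieldF; letI := T.instAlgebraF; letI := T.instFieldK;
        letI := T.instNumberFieldK; letI := T.instAlgebraK; letI := T.instFieldFbar; letI := T.instAlgebraFbar;
        letI := T.instAlgebraKFbar; letI := T.instIsElliptic;
      ℤ → ∀ v : (thetaIndex (pilotDataOfK T.D T.K)).V, v ∈ (thetaIndex (pilotDataOfK T.D T.K)).Vbad → (logShellsDH (pilotDataOfK T.D T.K) (analyticLogv T.K)).StarPacket v → Module.End ℚ ((logShellsDH (pilotDataOfK T.D T.K) (analyticLogv T.K)).StarPacket v))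
    (Mmod : ∀ (P : NFPoint) (l : ℕ) (T : Cor22.ThetaVolumeDatumAt P l), letI := T.instFieldF; letI := T.instNumberFieldF; letI := T.instAlgebraF; letI := T.instFieldK;
        letI := T.instNumberFieldK; letI := T.instAlgebraK; letI := T.instFieldFbar; letI := T.instAlgebraFbar;
        letI := T.instAlgebraKFbar; letI := T.instIsElliptic;
      ℤ → ∀ j : (thetaIndex (pilotDataOfK T.D T.K)).LabelStar, Set ((logShellsDH (pilotDataOfK T.D T.K) (analyticLogv T.K)).GlobalPacket j.1))
    (region : ∀ (P : NFPoint) (l : ℕ) (T : Cor22.ThetaVolumeDatumAt P l), letI := T.instFieldF; letI := T.instNumberFieldF; letI := T.instAlgebraF; letI := T.instFieldK;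
        letI := T.instNumberFieldK; letI := T.instAlgebraK; letI := T.instFieldFbar; letI := T.instAlgebraFbar;
        letI := T.instAlgebraKFbar; letI := T.instIsElliptic;
      ℤ → ∀ j : (thetaIndex (pilotDataOfK T.D T.K)).LabelStar, FinDivisor (M P l T) → ∀ vQ : (thetaIndex (pilotDataOfK T.D T.K)).VQ, Set ((logShellsDH (pilotDataOfK T.D T.K) (analyticLogv T.K)).Packet j.1 vQ))
    (frobAdm : ∀ (P : NFPoint) (l : ℕ) (T : Cor22.ThetaVolumeDatumAt P l), letI := T.instFieldF; letI := T.instNumberFieldF; letI := T.instAlgebraF; letI := T.instFieldK;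
        letI := T.instNumberFieldK; letI := T.instAlgebraK; letI := T.instFieldFbar; letI := T.instAlgebraFbar;
        letI := T.instAlgebraKFbar; letI := T.instIsElliptic;
      ℤ → ℤ → ∀ (j : (thetaIndex (pilotDataOfK T.D T.K)).Label) (vQ : (thetaIndex (pilotDataOfK T.D T.K)).VQ), Set ((logShellsDH (pilotDataOfK T.D T.K) (analyticLogv T.K)).Packet j vQ) → Prop)
    (frobLogvol : ∀ (P : NFPoint) (l : ℕ) (T : Cor22.ThetaVolumeDatumAt P l), letI := T.instFieldF; letI := T.instNumberFieldF; letI := T.instAlgebraF; letI := T.instFieldK;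
        letI := T.instNumberFieldK; letI := T.instAlgebraK; letI := T.instFieldFbar; letI := T.instAlgebraFbar;
        letI := T.instAlgebraKFbar; letI := T.instIsElliptic;
      ℤ → ℤ → ∀ (j : (thetaIndex (pilotDataOfK T.D T.K)).Label) (vQ : (thetaIndex (pilotDataOfK T.D T.K)).VQ), Set ((logShellsDH (pilotDataOfK T.D T.K) (analyticLogv T.K)).Packet j vQ) → ℝ)
    (frobΨ : ∀ (P : NFPoint) (l : ℕ) (T : Cor22.ThetaVolumeDatumAt P l), letI := T.instFieldF; letI := T.instNumberFieldF; letI := T.instAlgebraF; letI := T.instFieldK;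
        letI := T.instNumberFieldK; letI := T.instAlgebraK; letI := T.instFieldFbar; letI := T.instAlgebraFbar;
        letI := T.instAlgebraKFbar; letI := T.instIsElliptic;
      ℤ → ℤ → ∀ v : (thetaIndex (pilotDataOfK T.D T.K)).V, v ∈ (thetaIndex (pilotDataOfK T.D T.K)).Vbad → Set ((logShellsDH (pilotDataOfK T.D T.K) (analyticLogv T.K)).StarPacket v))
    (frobMmod : ∀ (P : NFPoint) (l : ℕ) (T : Cor22.ThetaVolumeDatumAt P l), letI := T.instFieldF; letI := T.instNumberFieldF; letI := T.instAlgebraF; letI := T.instFieldK;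
        letI := T.instNumberFieldK; letI := T.instAlgebraK; letI := T.instFieldFbar; letI := T.instAlgebraFbar;
        letI := T.instAlgebraKFbar; letI := T.instIsElliptic;
      ℤ → ℤ → ∀ j : (thetaIndex (pilotDataOfK T.D T.K)).LabelStar, Set ((logShellsDH (pilotDataOfK T.D T.K) (analyticLogv T.K)).GlobalPacket j.1))
    (unitImage : ∀ (P : NFPoint) (l : ℕ) (T : Cor22.ThetaVolumeDatumAt P l), letI := T.instFieldF; letI := T.instNumberFieldF; letI := T.instAlgebraF; letI := T.instFieldK;
        letI := T.instNumberFieldK; letI := T.instAlgebraK; letI := T.instFieldFbar; letI := T.instAlgebraFbar;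
        letI := T.instAlgebraKFbar; letI := T.instIsElliptic;
      ℤ → ℤ → ℕ → ∀ (j : (thetaIndex (pilotDataOfK T.D T.K)).Label) (vQ : (thetaIndex (pilotDataOfK T.D T.K)).VQ), Set ((logShellsDH (pilotDataOfK T.D T.K) (analyticLogv T.K)).Packet j vQ))
    (ballImage : ∀ (P : NFPoint) (l : ℕ) (T : Cor22.ThetaVolumeDatumAt P l), letI := T.instFieldF; letI := T.instNumberFieldF; letI := T.instAlgebraF; letI := T.instFieldK;
        letI := T.instNumberFieldK; letI := T.instAlgebraK; letI := T.instFieldFbar; letI := T.instAlgebraFbar;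
        letI := T.instAlgebraKFbar; letI := T.instIsElliptic;
      ℤ → ℤ → ∀ (j : (thetaIndex (pilotDataOfK T.D T.K)).Label) (vQ : (thetaIndex (pilotDataOfK T.D T.K)).VQ), Set ((logShellsDH (pilotDataOfK T.D T.K) (analyticLogv T.K)).Packet j vQ))
    (thetaDiv : ∀ (P : NFPoint) (l : ℕ) (T : Cor22.ThetaVolumeDatumAt P l), letI := T.instFieldF; letI := T.instNumberFieldF; letI := T.instAlgebraF; letI := T.instFieldK;
        letI := T.instNumberFieldK; letI := T.instAlgebraK; letI := T.instFieldFbar; letI := T.instAlgebraFbar;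
        letI := T.instAlgebraKFbar; letI := T.instIsElliptic;
      ℤ → ℤ → LgpDivisor (M P l T) (thetaIndex (pilotDataOfK T.D T.K)).lstar)
    (n : ∀ (P : NFPoint) (l : ℕ) (T : Cor22.ThetaVolumeDatumAt P l), ℤ)
    {HT : ∀ (P : NFPoint) (l : ℕ) (T : Cor22.ThetaVolumeDatumAt P l), Type} {LogLink : ∀ (P : NFPoint) (l : ℕ) (T : Cor22.ThetaVolumeDatumAt P l), HT P l T → HT P l T → Type}
    {IsFull : ∀ (P : NFPoint) (l : ℕ) (T : Cor22.ThetaVolumeDatumAt P l), ∀ {s t : HT P l T}, LogLink P l T s t → Prop}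
    (lat : ∀ (P : NFPoint) (l : ℕ) (T : Cor22.ThetaVolumeDatumAt P l), LGPGaussianLogThetaLattice (LogLink P l T) (IsFull P l T))
    {Frd : ∀ (P : NFPoint) (l : ℕ) (T : Cor22.ThetaVolumeDatumAt P l), Type} {IsoF : ∀ (P : NFPoint) (l : ℕ) (T : Cor22.ThetaVolumeDatumAt P l), Frd P l T → Frd P l T → Type} {Ob : ∀ (P : NFPoint) (l : ℕ) (T : Cor22.ThetaVolumeDatumAt P l), Frd P l T → Type}
    {realify : ∀ (P : NFPoint) (l : ℕ) (T : Cor22.ThetaVolumeDatumAt P l), Frd P l T → Frd P l T} {Strip : ∀ (P : NFPoint) (l : ℕ) (T : Cor22.ThetaVolumeDatumAt P l), Type} {IsoS : ∀ (P : NFPoint) (l : ℕ) (T : Cor22.ThetaVolumeDatumAt P l), Strip P l T → Strip P l T → Type}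
    {Mv : ∀ (P : NFPoint) (l : ℕ) (T : Cor22.ThetaVolumeDatumAt P l), letI := T.instFieldF; letI := T.instNumberFieldF; letI := T.instAlgebraF; letI := T.instFieldK;
        letI := T.instNumberFieldK; letI := T.instAlgebraK; letI := T.instFieldFbar; letI := T.instAlgebraFbar;
        letI := T.instAlgebraKFbar; letI := T.instIsElliptic;
      ∀ v : (thetaIndex (pilotDataOfK T.D T.K)).V, v ∈ (thetaIndex (pilotDataOfK T.D T.K)).Vbad → Type}
    [∀ P l T v h, Monoid (Mv P l T v h)]
    (sig : ∀ (P : NFPoint) (l : ℕ) (T : Cor22.ThetaVolumeDatumAt P l), letI := T.instFieldF; letI := T.instNumberFieldF; letI := T.instAlgebraF; letI := T.instFieldK;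
        letI := T.instNumberFieldK; letI := T.instAlgebraK; letI := T.instFieldFbar; letI := T.instAlgebraFbar;
        letI := T.instAlgebraKFbar; letI := T.instIsElliptic;
      GlobalLGPFrobenioidSignature (thetaIndex (pilotDataOfK T.D T.K)).lstar (thetaIndex (pilotDataOfK T.D T.K)).V (· ∈ (thetaIndex (pilotDataOfK T.D T.K)).Vbad) (Frd P l T) (IsoF P l T) (Ob P l T) (realify P l T)
        (Strip P l T) (IsoS P l T) (Mv P l T))
    (split : ∀ (P : NFPoint) (l : ℕ) (T : Cor22.ThetaVolumeDatumAt P l), SplittingMonoids (Mv P l T))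
    {ObΔ : ∀ (P : NFPoint) (l : ℕ) (T : Cor22.ThetaVolumeDatumAt P l), Type} {N : ∀ (P : NFPoint) (l : ℕ) (T : Cor22.ThetaVolumeDatumAt P l), letI := T.instFieldF; letI := T.instNumberFieldF; letI := T.instAlgebraF; letI := T.instFieldK;
        letI := T.instNumberFieldK; letI := T.instAlgebraK; letI := T.instFieldFbar; letI := T.instAlgebraFbar;
        letI := T.instAlgebraKFbar; letI := T.instIsElliptic;
      ∀ v : (thetaIndex (pilotDataOfK T.D T.K)).V, v ∈ (thetaIndex (pilotDataOfK T.D T.K)).Vbad → Type}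
    [∀ P l T v h, Monoid (N P l T v h)] (qData : ∀ (P : NFPoint) (l : ℕ) (T : Cor22.ThetaVolumeDatumAt P l), QPilotData (ObΔ P l T) (N P l T))
    (qK : ∀ (P : NFPoint) (l : ℕ) (T : Cor22.ThetaVolumeDatumAt P l), letI := T.instFieldF; letI := T.instNumberFieldF; letI := T.instAlgebraF; letI := T.instFieldK;
        letI := T.instNumberFieldK; letI := T.instAlgebraK; letI := T.instFieldFbar; letI := T.instAlgebraFbar;
        letI := T.instAlgebraKFbar; letI := T.instIsElliptic;
      ∀ v : (thetaIndex (pilotDataOfK T.D T.K)).V, v ∈ (thetaIndex (pilotDataOfK T.D T.K)).Vbad → Set ((logShellsDH (pilotDataOfK T.D T.K) (analyticLogv T.K)).StarPacket v))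

/-- **Per datum, reading (P): `SlotStatement` + the READ-P bound ⟹ `T.Cor312PerImageOf`** at the sharp K-setting of the CHOSEN realising ideles
(q-side READ: `negLogQ_settingPrVolSharp`, `absLogq_eq_ndeg_qPilot_pilotDataOfK`, `negAbsLogQ_eq_neg_absLogq_of_isVolumeInputOf`). Nothing asserted.
[cite: Mochizuki2012, IUTchIV Thm. 1.10 p. 23] [cite: DupuyHilado2025, §3.3] [claim: Mochizuki2012, status: disputed] -/
theorem GenuineKSlot.cor312PerImageOf_of_slotStatement {P : NFPoint} {l : ℕ} (T : Cor22.ThetaVolumeDatumAt P l)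
    (hst : letI := T.instFieldF; letI := T.instNumberFieldF; letI := T.instAlgebraF; letI := T.instFieldK;
        letI := T.instNumberFieldK; letI := T.instAlgebraK; letI := T.instFieldFbar; letI := T.instAlgebraFbar;
        letI := T.instAlgebraKFbar; letI := T.instIsElliptic;
      (settingPrVolSharp (pilotDataOfK T.D T.K) (logvAnalytic_analyticLogv (F := T.K)) (M P l T) (archPk P l T) (archSub P l T) (Ψ P l T)
          (act P l T) (Mmod P l T) (region P l T) (n P l T) (lat P l T) (sig P l T) (split P l T) (qData P l T)
          (exists_realising_qIdeles_pilotDataOfK T.D).choose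
          (exists_realising_thetaIdeles_pilotDataOfK T.D).choose
          (exists_realising_qIdeles_pilotDataOfK T.D).choose_spec.1
          (exists_realising_qIdeles_pilotDataOfK T.D).choose_spec.2.1).SlotStatement)
    (hread : letI := T.instFieldF; letI := T.instNumberFieldF; letI := T.instAlgebraF; letI := T.instFieldK;
        letI := T.instNumberFieldK; letI := T.instAlgebraK; letI := T.instFieldFbar; letI := T.instAlgebraFbar;
        letI := T.instAlgebraKFbar; letI := T.instIsElliptic;
      (settingPrVolSharp (pilotDataOfK T.D T.K) (logvAnalytic_analyticLogv (F := T.K)) (M P l T) (archPk P l T) (archSub P l T) (Ψ P l T)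
          (act P l T) (Mmod P l T) (region P l T) (n P l T) (lat P l T) (sig P l T) (split P l T) (qData P l T)
          (exists_realising_qIdeles_pilotDataOfK T.D).choose
          (exists_realising_thetaIdeles_pilotDataOfK T.D).choose
          (exists_realising_qIdeles_pilotDataOfK T.D).choose_spec.1
          (exists_realising_qIdeles_pilotDataOfK T.D).choose_spec.2.1).negLogThetaSlot ≤ ((T.negLogThetaPerImage : ℝ) : WithTop ℝ)) :
    T.Cor312PerImageOf := by
  letI := T.instFieldF; letI := T.instNumberFieldF; letI := T.instAlgebraF; letI := T.instFieldK
  letI := T.instNumberFieldK; letI := T.instAlgebraK; letI := T.instFieldFbar; letI := T.instAlgebraFbar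
  letI := T.instAlgebraKFbar; letI := T.instIsElliptic
  have hle := WithTop.coe_le_coe.mp (hst.2.trans hread)
  rw [negLogQ_settingPrVolSharp (pilotDataOfK T.D T.K) (logvAnalytic_analyticLogv (F := T.K)) (M P l T) (archPk P l T) (archSub P l T)
    (Ψ P l T) (act P l T) (Mmod P l T) (region P l T) (n P l T) (lat P l T) (sig P l T) (split P l T) (qData P l T)
    (exists_realising_thetaIdeles_pilotDataOfK T.D).choose (exists_realising_qIdeles_pilotDataOfK T.D).choose
    (exists_realising_qIdeles_pilotDataOfK T.D).choose_spec.1 (exists_realising_qIdeles_pilotDataOfK T.D).choose_spec.2.1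
    (exists_realising_qIdeles_pilotDataOfK T.D).choose_spec.2.2, ← absLogq_eq_ndeg_qPilot_pilotDataOfK T.D T.K] at hle
  show T.negAbsLogQ ≤ T.negLogThetaPerImage
  have h1 : T.negAbsLogQ = -Cor312Prov.absLogq T.D :=
    Cor312Prov.negAbsLogQ_eq_neg_absLogq_of_isVolumeInputOf T.D T.isVolumeInputOf
  rw [h1]
  exact hle

/-- **Per datum, reading (P): `SlotLicence` + the READ-P bound ⟹ `T.Cor312PerImageOf`** (monotone log-volume from abc-iut-c312-7's
`bridgeHyps_settingPrVolSharp_of_ideles`; finiteness of `−|log(Θ)|_(P)` from the READ-P bound; then `slotStatement_of_slotLicence`). Nothing asserted.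
[cite: Mochizuki2012, IUTchIII Prop. 3.9 (ii) p. 126, Cor. 3.12 Step (xi-f) p. 184] [claim: Mochizuki2012, status: disputed] -/
theorem GenuineKSlot.cor312PerImageOf_of_slotLicence {P : NFPoint} {l : ℕ} (T : Cor22.ThetaVolumeDatumAt P l)
    (hlic : letI := T.instFieldF; letI := T.instNumberFieldF; letI := T.instAlgebraF; letI := T.instFieldK;
        letI := T.instNumberFieldK; letI := T.instAlgebraK; letI := T.instFieldFbar; letI := T.instAlgebraFbar;
        letI := T.instAlgebraKFbar; letI := T.instIsElliptic;
      (settingPrVolSharp (pilotDataOfK T.D T.K) (logvAnalytic_analyticLogv (F := T.K)) (M P l T) (archPk P l T) (archSub P l T) (Ψ P l T)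
          (act P l T) (Mmod P l T) (region P l T) (n P l T) (lat P l T) (sig P l T) (split P l T) (qData P l T)
          (exists_realising_qIdeles_pilotDataOfK T.D).choose
          (exists_realising_thetaIdeles_pilotDataOfK T.D).choose
          (exists_realising_qIdeles_pilotDataOfK T.D).choose_spec.1
          (exists_realising_qIdeles_pilotDataOfK T.D).choose_spec.2.1).SlotLicence)
    (hread : letI := T.instFieldF; letI := T.instNumberFieldF; letI := T.instAlgebraF; letI := T.instFieldK;
        letI := T.instNumberFieldK; letI := T.instAlgebraK; letI := T.instFieldFbar; letI := T.instAlgebraFbar;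
        letI := T.instAlgebraKFbar; letI := T.instIsElliptic;
      (settingPrVolSharp (pilotDataOfK T.D T.K) (logvAnalytic_analyticLogv (F := T.K)) (M P l T) (archPk P l T) (archSub P l T) (Ψ P l T)
          (act P l T) (Mmod P l T) (region P l T) (n P l T) (lat P l T) (sig P l T) (split P l T) (qData P l T)
          (exists_realising_qIdeles_pilotDataOfK T.D).choose
          (exists_realising_thetaIdeles_pilotDataOfK T.D).choose
          (exists_realising_qIdeles_pilotDataOfK T.D).choose_spec.1
          (exists_realising_qIdeles_pilotDataOfK T.D).choose_spec.2.1).negLogThetaSlot ≤ ((T.negLogThetaPerImage : ℝ) : WithTop ℝ)) :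
    T.Cor312PerImageOf := by
  letI := T.instFieldF; letI := T.instNumberFieldF; letI := T.instAlgebraF; letI := T.instFieldK
  letI := T.instNumberFieldK; letI := T.instAlgebraK; letI := T.instFieldFbar; letI := T.instAlgebraFbar
  letI := T.instAlgebraKFbar; letI := T.instIsElliptic
  refine GenuineKSlot.cor312PerImageOf_of_slotStatement M archPk archSub Ψ act Mmod region n lat sig split qData T ?_ hread
  have hfin : (settingPrVolSharp (pilotDataOfK T.D T.K) (logvAnalytic_analyticLogv (F := T.K)) (M P l T) (archPk P l T) (archSub P l T) (Ψ P l T)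
          (act P l T) (Mmod P l T) (region P l T) (n P l T) (lat P l T) (sig P l T) (split P l T) (qData P l T)
          (exists_realising_qIdeles_pilotDataOfK T.D).choose
          (exists_realising_thetaIdeles_pilotDataOfK T.D).choose
          (exists_realising_qIdeles_pilotDataOfK T.D).choose_spec.1
          (exists_realising_qIdeles_pilotDataOfK T.D).choose_spec.2.1).ThetaSlotFinite := by
    by_contra hnf
    have htop : (settingPrVolSharp (pilotDataOfK T.D T.K) (logvAnalytic_analyticLogv (F := T.K)) (M P l T) (archPk P l T) (archSub P l T) (Ψ P l T)
          (act P l T) (Mmod P l T) (region P l T) (n P l T) (lat P l T) (sig P l T) (split P l T) (qData P l T)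
          (exists_realising_qIdeles_pilotDataOfK T.D).choose
          (exists_realising_thetaIdeles_pilotDataOfK T.D).choose
          (exists_realising_qIdeles_pilotDataOfK T.D).choose_spec.1
          (exists_realising_qIdeles_pilotDataOfK T.D).choose_spec.2.1).negLogThetaSlot = ⊤ := by
      unfold Cor312.Setting.negLogThetaSlot; rw [if_neg hnf]
    rw [htop] at hread
    exact absurd hread (by simp)
  exact Cor312.Setting.slotStatement_of_slotLicence _
    (bridgeHyps_settingPrVolSharp_of_ideles (pilotDataOfK T.D T.K) (logvAnalytic_analyticLogv (F := T.K)) (M P l T) (archPk P l T)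
      (archSub P l T) (Ψ P l T) (act P l T) (Mmod P l T) (region P l T) (n P l T) (lat P l T) (sig P l T) (split P l T) (qData P l T)
      (exists_realising_thetaIdeles_pilotDataOfK T.D).choose (exists_realising_qIdeles_pilotDataOfK T.D).choose
      (exists_realising_thetaIdeles_pilotDataOfK T.D).choose_spec.1 (exists_realising_thetaIdeles_pilotDataOfK T.D).choose_spec.2.1
      (exists_realising_qIdeles_pilotDataOfK T.D).choose_spec.1 (exists_realising_qIdeles_pilotDataOfK T.D).choose_spec.2.1).mono
    hfin hlic

/-- **`abc_of_slotLicence_orNumP_K_szpiroBad`** (the γ certificate, reading (P)) — `ABC` from: [NUM-P-OFF, Szpiro-bad] `hNumPOffBad` «at every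
admissible SZPIRO-BAD `(P, l)` and genuine `T` where OUR SLOT licence fails (sharp K-setting, chosen realising ideles), `T.Cor312PerImageOf`» ·
[READ-P] `hReadP` «`negLogThetaSlot ≤ ↑T.negLogThetaPerImage` at every genuine `T`» (to be discharged by abc-iut-s2-p7's «HΘP-K» slot-hull READ).
Explicit 2 → 1; CONE 0 · PIN 0 · SIDE 0. «`ABC` follows from these hypotheses as typed» — no side taken on [IUTchIII] Cor. 3.12, [IUTchIV] Thm. 1.10
or on the (U)/(P) reading; typed ≠ proved; instantiated ≠ endorsed. [claim: Mochizuki2012, status: disputed] [cite: DupuyHilado2025, §4.12] -/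
theorem abc_of_slotLicence_orNumP_K_szpiroBad
    (hNumPOffBad : ∀ (P : NFPoint), P ∈ UP → ∀ (l : ℕ), l.Prime → 5 ≤ l →
      Cor22.AdmitsCore P → Cor22.CondP2 P l → Cor22.CondP5 P l → Cor22.CondP6 P l →
      (((l : ℝ) + 5) / 4 < (Cor22.dmod P : ℝ) ∨
        6 * l * (((l : ℝ) + 5) - 4 * Cor22.dmod P) / (((l : ℝ) + 4) * ((l : ℝ) - 3))
            * (P.logDiff + (1 - 1 / (l : ℝ)) * Cor22.logCondAvoid P {2, l})
          + 6 * l * ((l : ℝ) + 5) / (((l : ℝ) + 4) * ((l : ℝ) - 3)) * Real.log Real.pi < Cor22.logQAvoid P {2, l}) →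
      ∀ (T : Cor22.ThetaVolumeDatumAt P l), letI := T.instFieldF; letI := T.instNumberFieldF; letI := T.instAlgebraF; letI := T.instFieldK;
        letI := T.instNumberFieldK; letI := T.instAlgebraK; letI := T.instFieldFbar; letI := T.instAlgebraFbar;
        letI := T.instAlgebraKFbar; letI := T.instIsElliptic;
      ¬ (settingPrVolSharp (pilotDataOfK T.D T.K) (logvAnalytic_analyticLogv (F := T.K)) (M P l T) (archPk P l T) (archSub P l T) (Ψ P l T)
          (act P l T) (Mmod P l T) (region P l T) (n P l T) (lat P l T) (sig P l T) (split P l T) (qData P l T)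
          (exists_realising_qIdeles_pilotDataOfK T.D).choose
          (exists_realising_thetaIdeles_pilotDataOfK T.D).choose
          (exists_realising_qIdeles_pilotDataOfK T.D).choose_spec.1
          (exists_realising_qIdeles_pilotDataOfK T.D).choose_spec.2.1).SlotLicence → T.Cor312PerImageOf)
    (hReadP : ∀ (P : NFPoint) (l : ℕ) (T : Cor22.ThetaVolumeDatumAt P l), letI := T.instFieldF; letI := T.instNumberFieldF; letI := T.instAlgebraF; letI := T.instFieldK;
        letI := T.instNumberFieldK; letI := T.instAlgebraK; letI := T.instFieldFbar; letI := T.instAlgebraFbar;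
        letI := T.instAlgebraKFbar; letI := T.instIsElliptic;
      (settingPrVolSharp (pilotDataOfK T.D T.K) (logvAnalytic_analyticLogv (F := T.K)) (M P l T) (archPk P l T) (archSub P l T) (Ψ P l T)
          (act P l T) (Mmod P l T) (region P l T) (n P l T) (lat P l T) (sig P l T) (split P l T) (qData P l T)
          (exists_realising_qIdeles_pilotDataOfK T.D).choose
          (exists_realising_thetaIdeles_pilotDataOfK T.D).choose
          (exists_realising_qIdeles_pilotDataOfK T.D).choose_spec.1
          (exists_realising_qIdeles_pilotDataOfK T.D).choose_spec.2.1).negLogThetaSlot ≤ ((T.negLogThetaPerImage : ℝ) : WithTop ℝ))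
    : _root_.ABC := by
  refine ABC_of_cor312PerImage fun P hP l hl h5 hc h2 h5' h6 T => ?_
  refine Cor22.forall_cor312PerImageOf_of_szpiroBad hP.1 h5 (fun _ => True) (fun hbad T' _ => ?_) T trivial
  letI := T'.instFieldF; letI := T'.instNumberFieldF; letI := T'.instAlgebraF; letI := T'.instFieldK
  letI := T'.instNumberFieldK; letI := T'.instAlgebraK; letI := T'.instFieldFbar; letI := T'.instAlgebraFbar
  letI := T'.instAlgebraKFbar; letI := T'.instIsElliptic
  by_cases hlic : (settingPrVolSharp (pilotDataOfK T'.D T'.K) (logvAnalytic_analyticLogv (F := T'.K)) (M P l T') (archPk P l T') (archSub P l T') (Ψ P l T')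
          (act P l T') (Mmod P l T') (region P l T') (n P l T') (lat P l T') (sig P l T') (split P l T') (qData P l T')
          (exists_realising_qIdeles_pilotDataOfK T'.D).choose
          (exists_realising_thetaIdeles_pilotDataOfK T'.D).choose
          (exists_realising_qIdeles_pilotDataOfK T'.D).choose_spec.1
          (exists_realising_qIdeles_pilotDataOfK T'.D).choose_spec.2.1).SlotLicence
  · exact GenuineKSlot.cor312PerImageOf_of_slotLicence M archPk archSub Ψ act Mmod region n lat sig split qData T' hlic (hReadP P l T')
  · exact hNumPOffBad P hP l hl h5 hc h2 h5' h6 hbad T' hlic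

/-- **`abc_of_slotStatement_genuineK_szpiroBad`** (the reading-(P) DOWNSTREAM statement line; (P) twin of abc-iut-s2-p10's
`abc_of_cor312Statement_genuineK_szpiroBad_hregBad` p455513 WITHOUT its cone binder) — `ABC` from: [C312-P, Szpiro-bad] `hstPBad` «the typed
Cor. 3.12 conclusion IN READING (P) (`SlotStatement`) of the sharp K-setting at the chosen realising ideles, at every admissible SZPIRO-BAD `(P, l)`
and genuine `T`» · [READ-P] `hReadP`. Explicit 2 → 1; CONE 0. «`ABC` follows from these hypotheses as typed» — nothing asserted about either; no side
taken on [IUTchIII] Cor. 3.12 or on (U)/(P); typed ≠ proved. [claim: Mochizuki2012, status: disputed] [cite: Mochizuki2012, IUTchIII Cor. 3.12 p. 174] -/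
theorem abc_of_slotStatement_genuineK_szpiroBad
    (hstPBad : ∀ (P : NFPoint), P ∈ UP → ∀ (l : ℕ), l.Prime → 5 ≤ l →
      Cor22.AdmitsCore P → Cor22.CondP2 P l → Cor22.CondP5 P l → Cor22.CondP6 P l →
      (((l : ℝ) + 5) / 4 < (Cor22.dmod P : ℝ) ∨
        6 * l * (((l : ℝ) + 5) - 4 * Cor22.dmod P) / (((l : ℝ) + 4) * ((l : ℝ) - 3))
            * (P.logDiff + (1 - 1 / (l : ℝ)) * Cor22.logCondAvoid P {2, l})
          + 6 * l * ((l : ℝ) + 5) / (((l : ℝ) + 4) * ((l : ℝ) - 3)) * Real.log Real.pi < Cor22.logQAvoid P {2, l}) →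
      ∀ (T : Cor22.ThetaVolumeDatumAt P l), letI := T.instFieldF; letI := T.instNumberFieldF; letI := T.instAlgebraF; letI := T.instFieldK;
        letI := T.instNumberFieldK; letI := T.instAlgebraK; letI := T.instFieldFbar; letI := T.instAlgebraFbar;
        letI := T.instAlgebraKFbar; letI := T.instIsElliptic;
      (settingPrVolSharp (pilotDataOfK T.D T.K) (logvAnalytic_analyticLogv (F := T.K)) (M P l T) (archPk P l T) (archSub P l T) (Ψ P l T)
          (act P l T) (Mmod P l T) (region P l T) (n P l T) (lat P l T) (sig P l T) (split P l T) (qData P l T)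
          (exists_realising_qIdeles_pilotDataOfK T.D).choose
          (exists_realising_thetaIdeles_pilotDataOfK T.D).choose
          (exists_realising_qIdeles_pilotDataOfK T.D).choose_spec.1
          (exists_realising_qIdeles_pilotDataOfK T.D).choose_spec.2.1).SlotStatement)
    (hReadP : ∀ (P : NFPoint) (l : ℕ) (T : Cor22.ThetaVolumeDatumAt P l), letI := T.instFieldF; letI := T.instNumberFieldF; letI := T.instAlgebraF; letI := T.instFieldK;
        letI := T.instNumberFieldK; letI := T.instAlgebraK; letI := T.instFieldFbar; letI := T.instAlgebraFbar;
        letI := T.instAlgebraKFbar; letI := T.instIsElliptic;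
      (settingPrVolSharp (pilotDataOfK T.D T.K) (logvAnalytic_analyticLogv (F := T.K)) (M P l T) (archPk P l T) (archSub P l T) (Ψ P l T)
          (act P l T) (Mmod P l T) (region P l T) (n P l T) (lat P l T) (sig P l T) (split P l T) (qData P l T)
          (exists_realising_qIdeles_pilotDataOfK T.D).choose
          (exists_realising_thetaIdeles_pilotDataOfK T.D).choose
          (exists_realising_qIdeles_pilotDataOfK T.D).choose_spec.1
          (exists_realising_qIdeles_pilotDataOfK T.D).choose_spec.2.1).negLogThetaSlot ≤ ((T.negLogThetaPerImage : ℝ) : WithTop ℝ))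
    : _root_.ABC := by
  refine ABC_of_cor312PerImage fun P hP l hl h5 hc h2 h5' h6 T => ?_
  exact Cor22.forall_cor312PerImageOf_of_szpiroBad hP.1 h5 (fun _ => True)
    (fun hbad T' _ => GenuineKSlot.cor312PerImageOf_of_slotStatement M archPk archSub Ψ act Mmod region n lat sig split qData T'
      (hstPBad P hP l hl h5 hc h2 h5' h6 hbad T') (hReadP P l T')) T trivial

end Family

end Summit.ABC.IUTFork.Conditional

end
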